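import Summits.BirchSwinnertonDyer.BirchSwinnertonDyer.Theorems.SchneiderFreeAdditiveX3BranchIMCLatticeTransport
import Summits.BirchSwinnertonDyer.BirchSwinnertonDyer.Theorems.SchneiderFreeAdditiveX3AnticyclotomicSelmerIsogeny
import Literature.NumberTheory.EllipticCurves.IsogenyGroundFieldExtension
import HarnessLib

/-!
# Route `SchneiderFreeAdditiveX3` (K1 door), crux `GordTwoBranchIMC` (stmt-BirchSwinnertonDyer-19177):
# the door direction (H3) is invariant under isogeny from a `μ = 0` curve

Cell `bsd-schneider-ideate`, seat `bsd-schneider-door-c3` (prover, generation 4). HONEST FRAMING: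
the composition of this seat's two helper files — the Λ-algebra lattice transport
(`…BranchIMCLatticeTransport.lean`: `μ = 0` ⇒ `Ch(X') ⊆ Ch(X)` along a Λ-map with `p`-power-killed
kernel/cokernel) and the comparison map (`…AnticyclotomicSelmerIsogeny.lean`: the Λ-linear
transpose `X_ac(φ)` of a `K`-isogeny, kernel and cokernel killed by a power of `p`). NOTHING is
asserted about BSD; the crux `GordTwoBranchIMC` (Keller–Yin arXiv:2410.23241 Thm. 3.5.1 at the
frame — PREPRINT) stays OPEN; `--supports` material for item 19177. What this settles: the crux's
recorded risk «lattice/isogeny choice `φ|_{G_p} ≠ 𝟙`» (KY prove their equality, with `μ(𝔛) = 0`,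
for ONE lattice per class, p. 17) costs the door NOTHING beyond `μ = 0` on that lattice — the "⊇"
half `Ch_Λ(X_ac)·R₀⟦T⟧ ⊆ (L)` (H3 = `SchneiderFree.BranchIMCDivAt` at a frame) passes to every
curve isogenous to it over `K`, with the SAME `L`: for ANY degree `p^m·d`, `p ∤ d`, the dual
isogeny of the tree (`Isogeny.exists_dual_of_isElliptic` with `Isogeny.surjective`) is the
quasi-inverse and `d` is a unit of `Λ` (`xac_charIdeal_le_of_isogeny_of_isElliptic`). Still
external: finite generation / torsion of both `X_ac` (the control corner), `μ = 0` for one curve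
(Keller–Yin), and the base change of a `ℚ`-isogeny to `K` as an
`Isogeny (W₁.baseChange K) (W₂.baseChange K)`.

References: Keller–Yin arXiv:2410.23241 §3.3 (p. 17), Thm. 3.5.1 (p. 20); Washington §13.2;
Castella 2018 §2.
-/

noncomputable section

open scoped Classical

open NumberField IsDedekindDomain Field PowerSeries
  Literature.NumberTheory.EllipticCurves
  Summit.BirchSwinnertonDyer.Rank1Residual.X11b.AcSelmer

set_option linter.dupNamespace false -- D-0017 layout: summit = sub-problem (mandated namespace)
set_option autoImplicit false

universe u

namespace Summit.BirchSwinnertonDyer.BirchSwinnertonDyer.Theorems.SchneiderFree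

/-! ## §4 H3 and `ord_p f_ac(0)` along a `p`-power isogeny (composition with the lattice transport) -/

section Transport

open Literature.NumberTheory.EllipticCurves.IwasawaAlgebra

variable {K : Type u} [Field K] [NumberField K] {p : ℕ} [Fact p.Prime] {W₁ W₂ : WeierstrassCurve K}
  (κ : ZpExtension K p) (𝔭 : HeightOneSpectrum (𝓞 K)) (S : Set (HeightOneSpectrum (𝓞 K)))
  (γ : absoluteGaloisGroup K) [hγ : Fact (κ.IsTopGenerator γ)]
  (φ : WeierstrassCurve.Isogeny W₁ W₂) (ψ : WeierstrassCurve.Isogeny W₂ W₁) (m : ℕ)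

/-- **The door divisibility is invariant under `p`-power isogeny, given `μ = 0` on the source.** For a
`K`-isogeny `φ : W₁ → W₂` with `p`-power quasi-inverse `ψ` (`ψ ∘ φ = [p^m] = φ ∘ ψ`), finitely
generated torsion `X_ac^Σ(W₁)`, `X_ac^Σ(W₂)` at the frame `(κ, γ, 𝔭)` and `μ(X_ac(W₁)) = 0`: if
`Ch_Λ(X_ac(W₁))·R' ⊆ (L)` along a ring map `e : Λ → R'` then `Ch_Λ(X_ac(W₂))·R' ⊆ (L)` for the SAME
`L` — `xac_charIdeal_map_le_transport'` fed the transpose `xacComap φ` and its `p^m`-killed kernel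
and cokernel. Reading: Keller–Yin's Thm. 3.5.1 for their lattice (μ = 0) yields H3 for every curve
`p`-power-isogenous to it over `K`. CONDITIONAL on the listed inputs; nothing asserted about BSD.
[cite: KellerYin2024b, §3.3 (arXiv:2410.23241 p. 17) (shape only; preprint)] [cite: Washington1997, §13.2] -/
theorem xac_charIdeal_map_le_of_isogeny
    (hψφ : ∀ P : W₁.geomPoints, ψ (φ P) = (p ^ m : ℕ) • P)
    (hφψ : ∀ Q : W₂.geomPoints, φ (ψ Q) = (p ^ m : ℕ) • Q)
    [Module.Finite (IwasawaAlgebra p) (XAc W₁ p κ 𝔭 S γ)]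
    [Module.Finite (IwasawaAlgebra p) (XAc W₂ p κ 𝔭 S γ)]
    (h₁ : Module.IsTorsion (IwasawaAlgebra p) (XAc W₁ p κ 𝔭 S γ))
    (h₂ : Module.IsTorsion (IwasawaAlgebra p) (XAc W₂ p κ 𝔭 S γ))
    (hμ : muInvariant p (XAc W₁ p κ 𝔭 S γ) = 0)
    {R' : Type*} [CommRing R'] (e : IwasawaAlgebra p →+* R') {L : R'}
    (hdiv : (XAc.charIdeal W₁ p κ 𝔭 S γ).map e ≤ Ideal.span {L}) :
    (XAc.charIdeal W₂ p κ 𝔭 S γ).map e ≤ Ideal.span {L} :=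
  xac_charIdeal_map_le_transport' W₁ W₂ κ 𝔭 S γ h₁ h₂ hμ
    (xacComap W₁ W₂ κ 𝔭 S (isogenyPrimaryMap φ) (isogenyPrimaryMap_smul φ) γ) m
    (fun y hy ↦ xacComap_ker_smul κ 𝔭 S γ φ ψ m hφψ y hy)
    (fun x ↦ xacComap_coker_smul κ 𝔭 S γ φ ψ m hψφ x) e hdiv

/-- **`Ch_Λ(X_ac(W₂)) ⊆ Ch_Λ(X_ac(W₁))` along a `p`-power isogeny from a `μ = 0` source** (the `Λ`-level
statement behind `xac_charIdeal_map_le_of_isogeny`). [cite: Washington1997, §13.2] -/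
theorem xac_charIdeal_le_of_isogeny
    (hψφ : ∀ P : W₁.geomPoints, ψ (φ P) = (p ^ m : ℕ) • P)
    (hφψ : ∀ Q : W₂.geomPoints, φ (ψ Q) = (p ^ m : ℕ) • Q)
    [Module.Finite (IwasawaAlgebra p) (XAc W₁ p κ 𝔭 S γ)]
    [Module.Finite (IwasawaAlgebra p) (XAc W₂ p κ 𝔭 S γ)]
    (h₁ : Module.IsTorsion (IwasawaAlgebra p) (XAc W₁ p κ 𝔭 S γ))
    (h₂ : Module.IsTorsion (IwasawaAlgebra p) (XAc W₂ p κ 𝔭 S γ))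
    (hμ : muInvariant p (XAc W₁ p κ 𝔭 S γ) = 0) :
    XAc.charIdeal W₂ p κ 𝔭 S γ ≤ XAc.charIdeal W₁ p κ 𝔭 S γ :=
  charIdeal_le_of_linearMap_of_muInvariant_eq_zero' h₁ h₂ hμ
    (xacComap W₁ W₂ κ 𝔭 S (isogenyPrimaryMap φ) (isogenyPrimaryMap_smul φ) γ) m
    (fun y hy ↦ xacComap_ker_smul κ 𝔭 S γ φ ψ m hφψ y hy)
    (fun x ↦ xacComap_coker_smul κ 𝔭 S γ φ ψ m hψφ x)

/-! ### Isogenies of arbitrary degree `p^m · d`, `p ∤ d`: the factor `d` is a unit of `Λ` -/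

/-- `((C n) • x)(c) = x(n • c)` on `X_ac` for every natural number `n` (constants act through
`ℤ_p → ℤ/p^k`). [cite: Lang1990, Ch. 5 §1] -/
theorem C_natCast_smul_apply (n : ℕ) (x : XAc W₁ p κ 𝔭 S γ) (c : selmerAc W₁ p κ 𝔭 S) :
    ((PowerSeries.C (n : ℤ_[p]) : IwasawaAlgebra p) • x) c = x (n • c) := by
  obtain ⟨k, hk⟩ := (isLocNil_conjSelmerAc_sub_one W₁ p κ 𝔭 S hγ.out).torsion c
  rw [XAc.C_smul_apply W₁ p κ 𝔭 S γ _ x hk, map_natCast, ZMod.val_natCast, ← map_nsmul,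
    IwasawaDual.mod_smul_eq hk]

/-- `Sel(ψ) ∘ Sel(φ) = n` on `Sel_𝔭^Σ(K_∞, W₁[p^∞])` when `ψ ∘ φ = [n]`. [folklore] -/
theorem selmerAcMap_selmerAcMap_eq_nsmul_of_comp (n : ℕ)
    (hψφ : ∀ P : W₁.geomPoints, ψ (φ P) = n • P) (c : selmerAc W₁ p κ 𝔭 S) :
    selmerAcMap W₂ W₁ κ 𝔭 S (isogenyPrimaryMap ψ) (isogenyPrimaryMap_smul ψ)
      (selmerAcMap W₁ W₂ κ 𝔭 S (isogenyPrimaryMap φ) (isogenyPrimaryMap_smul φ) c) = n • c := by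
  apply Subtype.ext
  rw [coe_selmerAcMap_apply, coe_selmerAcMap_apply, AddSubgroupClass.coe_nsmul]
  have hcomp : (isogenyPrimaryMap (p := p) ψ).comp (isogenyPrimaryMap (p := p) φ) =
      DistribSMul.toAddMonoidHom (W₁.geomPrimaryTorsion p) n := by
    ext P
    simp [hψφ]
  have e := DFunLike.congr_fun (coeffMapH1_comp κ.kerSubgroup (isogenyPrimaryMap (p := p) φ)
    (isogenyPrimaryMap_smul φ) (isogenyPrimaryMap (p := p) ψ) (isogenyPrimaryMap_smul ψ))
    (c : W₁.subgroupH1 p κ.kerSubgroup)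
  simp only [AddMonoidHom.comp_apply] at e
  rw [e, coeffMapH1_congr κ.kerSubgroup hcomp _ (nsmul_equivariant n), coeffMapH1_nsmul_apply]

/-- `C n = u · (C p)^m` in `Λ` with `u` a unit, for `n = p^m · d`, `p ∤ d` (`d` is a unit of `ℤ_p`,
hence `C d` a unit of `Λ`). [folklore] -/
theorem exists_unit_C_natCast_eq {m d : ℕ} (hd : ¬ p ∣ d) :
    ∃ u : (IwasawaAlgebra p)ˣ, (PowerSeries.C ((p ^ m * d : ℕ) : ℤ_[p]) : IwasawaAlgebra p) =
      ↑u * (PowerSeries.C (p : ℤ_[p]) : IwasawaAlgebra p) ^ m := by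
  have hu : IsUnit (PowerSeries.C (d : ℤ_[p]) : IwasawaAlgebra p) := by
    rw [PowerSeries.isUnit_iff_constantCoeff, PowerSeries.constantCoeff_C]
    exact IwasawaDual.isUnit_natCast_padicInt hd
  obtain ⟨u, hu⟩ := hu
  refine ⟨u, ?_⟩
  rw [hu, ← map_pow, ← map_mul, Nat.cast_mul, Nat.cast_pow, mul_comm]

/-- **Kernel of `X_ac(φ)` killed by `p^m` for an isogeny with quasi-inverse of degree `p^m · d`,
`p ∤ d`** (`φ ∘ ψ = [p^m d]`): `C(p^m d) = u · (C p)^m` with `u` a unit of `Λ`. [folklore] -/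
theorem xacComap_ker_smul_of_comp {m d : ℕ} (hd : ¬ p ∣ d)
    (hφψ : ∀ Q : W₂.geomPoints, φ (ψ Q) = (p ^ m * d) • Q) (x : XAc W₂ p κ 𝔭 S γ)
    (hx : xacComap W₁ W₂ κ 𝔭 S (isogenyPrimaryMap φ) (isogenyPrimaryMap_smul φ) γ x = 0) :
    (PowerSeries.C (p : ℤ_[p]) : IwasawaAlgebra p) ^ m • x = 0 := by
  have hn : (PowerSeries.C ((p ^ m * d : ℕ) : ℤ_[p]) : IwasawaAlgebra p) • x = 0 := by
    refine DFunLike.ext _ _ fun c ↦ ?_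
    rw [C_natCast_smul_apply, ← selmerAcMap_selmerAcMap_eq_nsmul_of_comp κ 𝔭 S ψ φ _ hφψ c,
      ← xacComap_apply, hx]
    rfl
  obtain ⟨u, hu⟩ := exists_unit_C_natCast_eq (p := p) (m := m) hd
  rw [hu, mul_smul] at hn
  simpa using congrArg (fun z ↦ (↑u⁻¹ : IwasawaAlgebra p) • z) hn

/-- **Cokernel of `X_ac(φ)` killed by `p^m`** (`ψ ∘ φ = [p^m d]`, `p ∤ d`). [folklore] -/
theorem xacComap_coker_smul_of_comp {m d : ℕ} (hd : ¬ p ∣ d)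
    (hψφ : ∀ P : W₁.geomPoints, ψ (φ P) = (p ^ m * d) • P) (y : XAc W₁ p κ 𝔭 S γ) :
    ∃ x : XAc W₂ p κ 𝔭 S γ, (PowerSeries.C (p : ℤ_[p]) : IwasawaAlgebra p) ^ m • y =
      xacComap W₁ W₂ κ 𝔭 S (isogenyPrimaryMap φ) (isogenyPrimaryMap_smul φ) γ x := by
  obtain ⟨u, hu⟩ := exists_unit_C_natCast_eq (p := p) (m := m) hd
  refine ⟨(↑u⁻¹ : IwasawaAlgebra p) •
    xacComap W₂ W₁ κ 𝔭 S (isogenyPrimaryMap ψ) (isogenyPrimaryMap_smul ψ) γ y, ?_⟩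
  have hn : (PowerSeries.C ((p ^ m * d : ℕ) : ℤ_[p]) : IwasawaAlgebra p) • y =
      xacComap W₁ W₂ κ 𝔭 S (isogenyPrimaryMap φ) (isogenyPrimaryMap_smul φ) γ
        (xacComap W₂ W₁ κ 𝔭 S (isogenyPrimaryMap ψ) (isogenyPrimaryMap_smul ψ) γ y) := by
    refine DFunLike.ext _ _ fun c ↦ ?_
    rw [C_natCast_smul_apply, xacComap_apply, xacComap_apply,
      selmerAcMap_selmerAcMap_eq_nsmul_of_comp κ 𝔭 S φ ψ _ hψφ c]
  rw [LinearMap.map_smul, ← hn, hu, mul_smul, ← mul_smul (↑u⁻¹ : IwasawaAlgebra p), Units.inv_mul,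
    one_smul]

/-- **H3 is invariant under ANY isogeny of elliptic curves over `K` from a `μ = 0` source**
(`Ch_Λ(X_ac(W₂)) ⊆ Ch_Λ(X_ac(W₁))`): write `deg φ = p^m · d` with `p ∤ d`; the dual isogeny `φ̂`
(tree `Isogeny.exists_dual_of_isElliptic`: `φ̂ ∘ φ = [deg φ]`; and `φ ∘ φ̂ = [deg φ]` because `φ` is
onto, tree `Isogeny.surjective`) is a quasi-inverse, `d` is a unit of `Λ`, and the lattice transport
applies to the transpose `X_ac(φ)`. CONDITIONAL on finite generation / torsion of both `X_ac` and
`μ(X_ac(W₁)) = 0`; nothing asserted about BSD. [cite: SilvermanAEC2009, Thm. III.6.1(a)]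
[cite: KellerYin2024b, §3.3 (arXiv:2410.23241 p. 17) (shape only; preprint)] [cite: Washington1997, §13.2] -/
theorem xac_charIdeal_le_of_isogeny_of_isElliptic [W₁.IsElliptic] [W₂.IsElliptic]
    (φ : WeierstrassCurve.Isogeny W₁ W₂) {m d : ℕ} (hdeg : φ.degree = p ^ m * d) (hd : ¬ p ∣ d)
    [Module.Finite (IwasawaAlgebra p) (XAc W₁ p κ 𝔭 S γ)]
    [Module.Finite (IwasawaAlgebra p) (XAc W₂ p κ 𝔭 S γ)]
    (h₁ : Module.IsTorsion (IwasawaAlgebra p) (XAc W₁ p κ 𝔭 S γ))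
    (h₂ : Module.IsTorsion (IwasawaAlgebra p) (XAc W₂ p κ 𝔭 S γ))
    (hμ : muInvariant p (XAc W₁ p κ 𝔭 S γ) = 0) :
    XAc.charIdeal W₂ p κ 𝔭 S γ ≤ XAc.charIdeal W₁ p κ 𝔭 S γ := by
  obtain ⟨ψ, hψ⟩ := φ.exists_dual_of_isElliptic
  have hψφ : ∀ P : W₁.geomPoints, ψ (φ P) = (p ^ m * d) • P := fun P ↦ by
    rw [hψ, hdeg, natCast_zsmul]
  have hφψ : ∀ Q : W₂.geomPoints, φ (ψ Q) = (p ^ m * d) • Q := fun Q ↦ by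
    obtain ⟨P, rfl⟩ := φ.surjective Q
    rw [hψφ, map_nsmul]
  exact charIdeal_le_of_linearMap_of_muInvariant_eq_zero' h₁ h₂ hμ
    (xacComap W₁ W₂ κ 𝔭 S (isogenyPrimaryMap φ) (isogenyPrimaryMap_smul φ) γ) m
    (fun y hy ↦ xacComap_ker_smul_of_comp κ 𝔭 S γ φ ψ hd hφψ y hy)
    (fun x ↦ xacComap_coker_smul_of_comp κ 𝔭 S γ φ ψ hd hψφ x)

/-- The same along any ring map `e : Λ → R'` (for the crux: base change to `R₀⟦T⟧`): the frame
divisibility `Ch_Λ(X_ac(W₁))·R' ⊆ (L)` passes to `W₂` with the SAME `L`. CONDITIONAL; nothing asserted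
about BSD. [cite: KellerYin2024b, Thm. 3.5.1 (arXiv:2410.23241 p. 20) (shape only; preprint)] -/
theorem xac_charIdeal_map_le_of_isogeny_of_isElliptic [W₁.IsElliptic] [W₂.IsElliptic]
    (φ : WeierstrassCurve.Isogeny W₁ W₂) {m d : ℕ} (hdeg : φ.degree = p ^ m * d) (hd : ¬ p ∣ d)
    [Module.Finite (IwasawaAlgebra p) (XAc W₁ p κ 𝔭 S γ)]
    [Module.Finite (IwasawaAlgebra p) (XAc W₂ p κ 𝔭 S γ)]
    (h₁ : Module.IsTorsion (IwasawaAlgebra p) (XAc W₁ p κ 𝔭 S γ))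
    (h₂ : Module.IsTorsion (IwasawaAlgebra p) (XAc W₂ p κ 𝔭 S γ))
    (hμ : muInvariant p (XAc W₁ p κ 𝔭 S γ) = 0)
    {R' : Type*} [CommRing R'] (e : IwasawaAlgebra p →+* R') {L : R'}
    (hdiv : (XAc.charIdeal W₁ p κ 𝔭 S γ).map e ≤ Ideal.span {L}) :
    (XAc.charIdeal W₂ p κ 𝔭 S γ).map e ≤ Ideal.span {L} :=
  (Ideal.map_mono (xac_charIdeal_le_of_isogeny_of_isElliptic κ 𝔭 S γ φ hdeg hd h₁ h₂ hμ)).trans hdiv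

end Transport

/-! ## §5 (append) The door's curves: a `ℚ`-isogeny of elliptic curves, base-changed to the Heegner field `K` -/

section Rat

open Literature.NumberTheory.EllipticCurves.IwasawaAlgebra

variable {p : ℕ} [Fact p.Prime] {W₁ W₂ : WeierstrassCurve ℚ} [W₁.IsElliptic] [W₂.IsElliptic]
  {K : Type} [Field K] [NumberField K]
  (κ : ZpExtension K p) (𝔭 : HeightOneSpectrum (𝓞 K)) (S : Set (HeightOneSpectrum (𝓞 K)))
  (γ : absoluteGaloisGroup K) [hγ : Fact (κ.IsTopGenerator γ)]

/-- **H3 is invariant along every `ℚ`-isogeny of the class, read over `K`.** For elliptic curves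
`W₁, W₂ /ℚ`, a `ℚ`-isogeny `φ : W₁ → W₂` of degree `p^m · d` with `p ∤ d` (ANY degree, so written),
a number field `K` and one anticyclotomic frame `(κ, γ, 𝔭, Σ)` — the crux's objects are
`X_ac^Σ((Wᵢ)_K[p^∞])`: if both are finitely generated torsion and `μ(X_ac((W₁)_K)) = 0`, then
`Ch_Λ(X_ac((W₂)_K)) ⊆ Ch_Λ(X_ac((W₁)_K))`. The isogeny is base-changed by the tree's
`Isogeny.extendScalars K` ("an isogeny defined over `ℚ` is defined over `K`", same degree), and
`xac_charIdeal_le_of_isogeny_of_isElliptic` applies. Reading for the crux: Keller–Yin's lattice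
(μ = 0, Thm. 3.5.1) ⇒ H3 at the frame for EVERY curve of the `ℚ`-isogeny class (every `W` the crux
quantifies over), modulo the control corner's finiteness. CONDITIONAL; nothing asserted about BSD.
[cite: SilvermanAEC2009, III.§4 (p. 66) and Thm. III.6.1(a)]
[cite: KellerYin2024b, §3.3 (arXiv:2410.23241 p. 17) (shape only; preprint)] -/
theorem xac_charIdeal_le_of_ratIsogeny (φ : WeierstrassCurve.Isogeny W₁ W₂) {m d : ℕ}
    (hdeg : φ.degree = p ^ m * d) (hd : ¬ p ∣ d)
    [Module.Finite (IwasawaAlgebra p) (XAc (W₁.baseChange K) p κ 𝔭 S γ)]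
    [Module.Finite (IwasawaAlgebra p) (XAc (W₂.baseChange K) p κ 𝔭 S γ)]
    (h₁ : Module.IsTorsion (IwasawaAlgebra p) (XAc (W₁.baseChange K) p κ 𝔭 S γ))
    (h₂ : Module.IsTorsion (IwasawaAlgebra p) (XAc (W₂.baseChange K) p κ 𝔭 S γ))
    (hμ : muInvariant p (XAc (W₁.baseChange K) p κ 𝔭 S γ) = 0) :
    XAc.charIdeal (W₂.baseChange K) p κ 𝔭 S γ ≤ XAc.charIdeal (W₁.baseChange K) p κ 𝔭 S γ :=
  xac_charIdeal_le_of_isogeny_of_isElliptic κ 𝔭 S γ (φ.extendScalars K)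
    (by rw [WeierstrassCurve.Isogeny.degree_extendScalars, hdeg]) hd h₁ h₂ hμ

/-- The same along any ring map `e : Λ → R'` (the crux: base change to `R₀⟦T⟧`): the frame
divisibility `Ch_Λ(X_ac((W₁)_K))·R' ⊆ (L)` passes to `(W₂)_K` with the SAME `L`, for every curve `W₂`
`ℚ`-isogenous to `W₁`. CONDITIONAL; nothing asserted about BSD.
[cite: KellerYin2024b, Thm. 3.5.1 (arXiv:2410.23241 p. 20) (shape only; preprint)] -/
theorem xac_charIdeal_map_le_of_ratIsogeny (φ : WeierstrassCurve.Isogeny W₁ W₂) {m d : ℕ}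
    (hdeg : φ.degree = p ^ m * d) (hd : ¬ p ∣ d)
    [Module.Finite (IwasawaAlgebra p) (XAc (W₁.baseChange K) p κ 𝔭 S γ)]
    [Module.Finite (IwasawaAlgebra p) (XAc (W₂.baseChange K) p κ 𝔭 S γ)]
    (h₁ : Module.IsTorsion (IwasawaAlgebra p) (XAc (W₁.baseChange K) p κ 𝔭 S γ))
    (h₂ : Module.IsTorsion (IwasawaAlgebra p) (XAc (W₂.baseChange K) p κ 𝔭 S γ))
    (hμ : muInvariant p (XAc (W₁.baseChange K) p κ 𝔭 S γ) = 0)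
    {R' : Type*} [CommRing R'] (e : IwasawaAlgebra p →+* R') {L : R'}
    (hdiv : (XAc.charIdeal (W₁.baseChange K) p κ 𝔭 S γ).map e ≤ Ideal.span {L}) :
    (XAc.charIdeal (W₂.baseChange K) p κ 𝔭 S γ).map e ≤ Ideal.span {L} :=
  (Ideal.map_mono (xac_charIdeal_le_of_ratIsogeny κ 𝔭 S γ φ hdeg hd h₁ h₂ hμ)).trans hdiv

end Rat

end Summit.BirchSwinnertonDyer.BirchSwinnertonDyer.Theorems.SchneiderFree

end
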